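import Summits.Schanuel.Schanuel.Theorems.RootDecomp1KHyperellipticSiegel01

/-!
# RootDecomp1KHyperellipticSiegel — lens 1, generation 62, NODE 23 «HYPERELLIPTIC SIEGEL ON THE K-LINE — the dominant live sector» (Siegel's theorem for y² = f(x), f separable of degree ≥ 3, over any number field — AEC IX.4.3 — PROVED from the tree's unit equation and cubic case; the engine on DOMINANT x-degree-2 pairs c₂x² + c₁x + c₀ (deg c₁, deg c₂ < deg c₀) with separable x-discriminant of degree ≥ 3 ⇒ SiegelClause / LevelFinite / ThinFibreAt ∀ m₀ / BddLevelEmpty, intrinsically the class DomHyper P; the genus-two family M j := x² + 3Y·x + (Y⁵ + 9jY + 9j + 3) decided hypothesis-free ∀ j ∈ ℤ; the territory M_territory incl. 2-adic liveness by size at m₀ = 2; CLAIM L2879, PRICE L2882, K-R54) — continuation (RootDecomp1KHyperellipticSiegel02): §E the engine on dominant x-degree-2 pairs (pDisc = xDisc, completing the square, dyadic integrality, badT, Siegel over ℚ ⇒ finitely many ordinates / dyadic abscissae / dyadic points ⇒ SiegelClause / LevelFinite / ThinFibreAt ∀ m₀ / BddLevelEmpty via the tree doors) and §E′ the intrinsic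 class DomHyper P with its theorems (section Engine)

(lens-1 g62 NODE 23 «HYPERELLIPTIC SIEGEL ON THE K-LINE — the DOMINANT LIVE SECTOR» L2903: HOME kernel K = HOME/decomp-schanuel-lens-1/g62/lean/HyperellipticSiegel.lean sha256 f4b0f073…, 1239 l, 124 theorems + 8 defs, ONE namespace `Summit.Schanuel.Schanuel.Theorems.RootDecomp1KHyperellipticSiegel`, imports the tree port …RootDecomp1KSiegelGenusOne05 ONLY (the PROVED Literature modules Literature.NumberTheory.DiophantineGeometry.{SiegelCubicReduction, UnitEquationFinite, SIntegersFiniteExtension} and EllipticCurves.{KummerSelmerGroupFinite, TwoDescentParity} arrive transitively, BUILT; no …Proofs umbrella, no fact file); no private, no instance, no set_option, no notation, no sorry, no native_decide / decide; farm of record (lens): K rc 0 · 0 errors · 0 sorries, Probe rc 0 (211 `#print axioms` guards, standard triple), Ctrl0 rc 0, Ctrl rc 1 = 42 planted errors exactly; CLAIM L2879, crit g11 PRICE L2882 (PAYABLE THEOREM ×1 EX ANTE for (L)+(E)+(F)+(T) jointly under K-R53 (iii) prong 4; CHECKLIST K-g62 (1)–(11); RULE K-R54 PRE-ANNOUNCED),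 census LIVENESS-v24/v25/v26 (rows M 67 / M 144 / X3; keys hsE / galq / genus_torus of record L2882 / L2893 / L2897), crit g12 RULING L2893 (X3 = standing witness of the dominant-far sector), ADVANCE NOTICE L2901 (a) (engine generality DomZero 2), writer g32/g33 NOTES 14 / 1 / 2 / 4 (pre-kernel arithmetic incl. the real place; X3 certificate; DomHyper flips), critic VERDICT (crit g12): CLEARED — THEOREM ×1 for (L)+(E)+(F)+(T) JOINTLY, ONE credit (K-R53 (iii) prong 4), VERDICT L2907 (crit g12): CHECKLIST K-g62 (1)–(11) met item by item on the critic's own farm runs (K c679d0af… rc 0 · 0 errors · 0 sorries; Probe a3866a38… rc 0 with 211 `#print axioms` guards ⊆ the standard triple; Ctrl0 rc 0; Ctrl rc 1 = exactly the 42 planted errors; L_standalone rc 0 ⇒ §L uses nothing from the K-line); ERRATUM OF RECORD E1 = lens ADDENDUM 1 L2904 (memo only: (E) as typed = node 15's c₀-dominance `DomZero 2` reaches seven tabled LIVENESS rows — M 67, M 144 + the by-product rows contactC / highContactC / quinticP / RC2 / GC2 «reachable, not instantiated»); LABEL OF RECORD: literature KNOWN TOOL (Siegel 1926 / LeVeque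 1964; AEC IX.4.3; B–G 5.2.1 for U) · tree-NEW PROVED THEOREM · problem-relative NEW LEVER on the K-line (the first genus-≥ 2 class decided; integral-point Siegel consumed directly); TALLY lens-1 ×20 + THEOREM ×22; RULE K-R54 FIXED ((i) toolkit ∪= integral-point Siegel in general = ×0-as-record after node 23; (ii) open territory at m₀ = 2 := K-R53 (ii) territory not reached by (i) ∪ K-R53 (i), two named sectors with standing witnesses W4 (non-dominant) and X3 (dominant-far); (iii) payable clause; (iv) unconditional part ∪= the node-23 tree names after the port); lens DONE L2909; PORT GO L2908 exactly as census STAGING NOTE 13 L2905 (five parts; the one pre-emptive privatisation accepted; chain import as staged). Port by census-1 gen 24 per NODE-g62.md §(11) as `RootDecomp1KHyperellipticSiegel01–05` (`--supports stmt-Schanuel-33364`; the item stays OPEN; no census credit): 01 = §L Siegel's theorem for y² = f(x) in full (sections Parity, Cofactor; `exists_numberField_forall_isSquare_of_even`; `finite_integer_sq_eq_of_unitEquation` with the tree's U-binder verbatim; `finite_integer_sq_eq` unconditional) — the ONLY part whose proofs touch Literature names, all CITED by name (`finite_unitEquation`, `finite_integer_sq_eq_cubic_of_unitEquation`, `exists_numberField_forall_mem_selmerGroup_isSquare`,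 `exists_finite_forall_mem_integer_algebraMap`, `IsDedekindDomain.mk_mem_selmerGroup_iff`, `setOf_valuation_ne_one_finite`, `setOf_one_lt_valuation_finite`), never restated; 02 = §E the engine on dominant x-degree-2 pairs (`pDisc`, `xDisc_xPolyP_two`, `sq_eq_aeval_pDisc`, `den_dvd_of_dyadic`, `badT`, `ordinate_mem_integer`, `fibrePoly_ne_zero`, `finite_ordinates_dom2` … `finite_pointed_levels_dom2`) + §E′ the intrinsic class (`DomHyper`, `domHyper_xPolyP_iff`, `thinFibreAt_of_domHyper`, `levelFinite_of_domHyper`, `siegelClause_of_domHyper`, `bddLevelEmpty_of_domHyper`, …) (section Engine); 03 = §F the family M j (`mQ`, `mC`, `M`, `mD`, `isEisensteinAt_mD`, `domHyper_M`, `levelFinite_M`, `thinFibreAt_M`, `bddLevelEmpty_M`, `siegelClause_M`, `finite_dyadicPoints_M`) (section Family); 04 = §T part 1 (numerology, shape refusals, `presentation_M`, rootless / decided / slope / local / Gauss refusals, `thinFibreAt_M_of_three_le`, `irreducible_xDisc_M`) (section Territory, to be continued); 05 = §T part 2 (the anchor (1, −1), odd/tangent-emptiness refusals, real roots, (T-2)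 `den_pow_five_le_M` / `den_pow_lt_M` / `not_thin_ineq_two_M`, `thinFibreAt_two_iff_levelFinite_M`, `M_territory`, `M'`, `M'_zero` / `M'_one`, `M'_territory`) (section Territory re-opened with K's own open-lines). Text = K VERBATIM (every declaration of K is documented by the lens; statements and proofs unchanged; the module docstring of K kept in part 01 below this provenance block).)
-/

noncomputable section

namespace Summit.Schanuel.Schanuel.Theorems.RootDecomp1KHyperellipticSiegel

open Polynomial IsDedekindDomain NumberField
open scoped Classical WithZero
open Literature.NumberTheory.DiophantineGeometry (finite_integer_sq_eq_cubic_of_unitEquation finite_unitEquation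
  exists_numberField_forall_mem_selmerGroup_isSquare exists_finite_forall_mem_integer_algebraMap)
open IsDedekindDomain.HeightOneSpectrum (setOf_valuation_ne_one_finite setOf_one_lt_valuation_finite)

/-! ### §E  THE ENGINE ON THE K-LINE: DOMINANT PAIRS OF `x`-DEGREE 2 — `c₂(Y)·x² + c₁(Y)·x + c₀(Y)`,
`deg c₁, deg c₂ < deg c₀`, `x`-discriminant `Δ = c₁² − 4c₀c₂` SEPARABLE of degree `≥ 3` — NO SLOPE CONDITION -/

section Engine

open LiouvilleNumber
open scoped Nat
open Summit.Schanuel.Schanuel.Theorems.RootDecomp1KDegreeLadder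
open Summit.Schanuel.Schanuel.Theorems.RootDecomp1KXLinear (aeval_ratCast)
open Summit.Schanuel.Schanuel.Theorems.RootDecomp1KXTop
open Summit.Schanuel.Schanuel.Theorems.RootDecomp1KXAll
open Summit.Schanuel.Schanuel.Theorems.RootDecomp1KLevelFinite
open Summit.Schanuel.Schanuel.Theorems.RootDecomp1KIntegrality (DomZero rat_den_dvd_leadingCoeff GaussAt
  gaussAt_xPolyP_iff thinFibreAt_of_gaussAt)
open Summit.Schanuel.Schanuel.Theorems.RootDecomp1KHeightGrading (BddLevelEmpty bddLevelEmpty_iff_levelFinite)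
open Summit.Schanuel.Schanuel.Theorems.RootDecomp1KCubicDescent (xDisc)
open Literature.NumberTheory.DiophantineGeometry (valuation_eq_one_of_mul_eq_one)

/-- [datum] the `x`-DISCRIMINANT of a presentation `c`: `Δ(c) = c₁² − 4·c₀·c₂ ∈ ℤ[Y]` — the tree's INTRINSIC
`xDisc` (node 20) read on `xPolyP 2 c` (`xDisc_xPolyP_two`): COMPUTED FROM THE COEFFICIENTS, no per-member datum. -/
def pDisc (c : ℕ → ℤ[X]) : ℤ[X] := c 1 ^ 2 - 4 * c 0 * c 2

/-- `xDisc (xPolyP 2 c) = pDisc c` — the tree's intrinsic `x`-discriminant of the presentation. -/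
theorem xDisc_xPolyP_two (c : ℕ → ℤ[X]) : xDisc (xPolyP 2 c) = pDisc c := by
  rw [xDisc, pDisc, xCoeff_xPolyP, xCoeff_xPolyP, xCoeff_xPolyP, if_pos (by norm_num), if_pos (by norm_num),
    if_pos (by norm_num)]

/-- `bev (xPolyP 2 c) x y = c₀(y) + x·c₁(y) + x²·c₂(y)`. -/
theorem bev_xPolyP_two (c : ℕ → ℤ[X]) (x y : ℝ) :
    bev (xPolyP 2 c) x y = aeval y (c 0) + x * aeval y (c 1) + x ^ 2 * aeval y (c 2) := by
  rw [bev_xPolyP]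
  simp only [Finset.sum_range_succ, Finset.sum_range_zero, pow_zero, one_mul, zero_add, pow_one]

/-- the RATIONAL identity at a rational point of `xPolyP 2 c`. -/
theorem ratEq_of_bev_two {c : ℕ → ℤ[X]} {ξ r : ℚ} (h : bev (xPolyP 2 c) ξ r = 0) :
    aeval r (c 0) + ξ * aeval r (c 1) + ξ ^ 2 * aeval r (c 2) = 0 := by
  have h1 : (((aeval r (c 0) + ξ * aeval r (c 1) + ξ ^ 2 * aeval r (c 2) : ℚ)) : ℝ) = bev (xPolyP 2 c) ξ r := by
    rw [bev_xPolyP_two]; push_cast; rw [aeval_ratCast (c 0) r, aeval_ratCast (c 1) r, aeval_ratCast (c 2) r]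
  exact_mod_cast h1.trans h

/-- **COMPLETING THE SQUARE**: at a rational point, `u := 2c₂(r)ξ + c₁(r)` satisfies `u² = Δ(r)`. -/
theorem sq_eq_aeval_pDisc {c : ℕ → ℤ[X]} {ξ r : ℚ}
    (h : aeval r (c 0) + ξ * aeval r (c 1) + ξ ^ 2 * aeval r (c 2) = 0) :
    (2 * aeval r (c 2) * ξ + aeval r (c 1)) ^ 2 = aeval r (pDisc c) := by
  simp only [pDisc, map_sub, map_mul, map_pow, map_ofNat]
  linear_combination (4 * aeval r (c 2)) * h

/-- **INTEGRALITY OF ORDINATES OVER DYADIC ABSCISSAE, under dominance of `c₀` (any `x`-degree `k`)**: if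
`Σ_{j ≤ k} ξ^j c_j(r) = 0` with `den ξ = 2^t`, then `den r ∣ 2^{k t}·lc(c₀)` — Gauss's lemma on the cleared integer
polynomial `Σ_j num(ξ)^j 2^{(k−j)t} c_j(Y)`, whose leading coefficient `2^{kt}·lc(c₀)` does not see `num(ξ)`
(node 15's `den_dvd_of_level` is the case `ξ = s_N`). -/
theorem den_dvd_of_dyadic (k : ℕ) (c : ℕ → ℤ[X]) (hdom : DomZero k c) (h0 : c 0 ≠ 0) {ξ r : ℚ} {t : ℕ}
    (hξ : ξ.den = 2 ^ t) (hP : ∑ j ∈ Finset.range (k + 1), ξ ^ j * aeval r (c j) = 0) :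
    (r.den : ℤ) ∣ 2 ^ (k * t) * (c 0).leadingCoeff := by
  set Q : ℤ[X] := ∑ j ∈ Finset.range (k + 1), C (ξ.num ^ j * 2 ^ ((k - j) * t)) * c j with hQ_def
  -- `ξ · 2^t = num(ξ)`
  have hx : ξ * 2 ^ t = ξ.num := by
    have := Rat.mul_den_eq_num ξ
    rw [hξ] at this
    exact_mod_cast this
  -- `aeval r Q = 2^{kt} · Σ ξ^j c_j(r) = 0`
  have hQr : aeval r Q = 0 := by
    have key : aeval r Q = 2 ^ (k * t) * ∑ j ∈ Finset.range (k + 1), ξ ^ j * aeval r (c j) := by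
      rw [hQ_def, map_sum, Finset.mul_sum]
      refine Finset.sum_congr rfl fun j hj => ?_
      have hjk : j ≤ k := by have := Finset.mem_range.mp hj; omega
      have hpow : (2 : ℚ) ^ (k * t) = 2 ^ ((k - j) * t) * (2 ^ t) ^ j := by
        rw [← pow_mul, ← pow_add]; congr 1
        have : (k - j) * t + t * j = k * t := by rw [mul_comm t j, ← add_mul, Nat.sub_add_cancel hjk]
        omega
      rw [map_mul, eq_intCast, map_intCast]
      push_cast
      rw [← hx, hpow]
      ring
    rw [key, hP, mul_zero]
  -- the leading coefficient of `Q` is `2^{kt}·lc(c₀)`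
  have hlcQ : Q.leadingCoeff = 2 ^ (k * t) * (c 0).leadingCoeff := by
    rw [hQ_def, Finset.sum_range_succ']
    simp only [pow_zero, one_mul, Nat.sub_zero]
    have hdeg0 : (C ((2 : ℤ) ^ (k * t)) * c 0).degree = (c 0).degree := degree_C_mul (pow_ne_zero _ two_ne_zero)
    have hlt : (∑ j ∈ Finset.range k, C (ξ.num ^ (j + 1) * 2 ^ ((k - (j + 1)) * t)) * c (j + 1)).degree <
        (C ((2 : ℤ) ^ (k * t)) * c 0).degree := by
      rw [hdeg0]
      refine lt_of_le_of_lt (degree_sum_le _ _) ?_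
      rw [Finset.sup_lt_iff (bot_lt_iff_ne_bot.mpr (degree_ne_bot.mpr h0))]
      intro j hj
      have hjk : j + 1 ≤ k := by have := Finset.mem_range.mp hj; omega
      refine lt_of_le_of_lt (degree_mul_le _ _) ?_
      refine lt_of_le_of_lt (add_le_add degree_C_le le_rfl) ?_
      rw [zero_add, degree_eq_natDegree h0]
      by_cases hcj : c (j + 1) = 0
      · rw [hcj, degree_zero]; exact WithBot.bot_lt_coe _
      · rw [degree_eq_natDegree hcj]
        exact_mod_cast hdom (j + 1) (by omega) hjk
    rw [leadingCoeff_add_of_degree_lt hlt, leadingCoeff_mul, leadingCoeff_C]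
  exact hlcQ ▸ rat_den_dvd_leadingCoeff Q r hQr

/-- [datum] the finite set of «bad» finite places `T(m) = {v : v(2) ≠ 1} ∪ {v : v(m) ≠ 1}` of `ℚ` (the primes of `2m`). -/
def badT (m : ℤ) : Set (HeightOneSpectrum (𝓞 ℚ)) :=
  {v | v.valuation ℚ (2 : ℚ) ≠ 1} ∪ {v | v.valuation ℚ (m : ℚ) ≠ 1}

/-- `T(m)` is finite for `m ≠ 0`. -/
theorem badT_finite {m : ℤ} (hm : m ≠ 0) : (badT m).Finite :=
  (setOf_valuation_ne_one_finite two_ne_zero).union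
    (setOf_valuation_ne_one_finite (by exact_mod_cast hm : (m : ℚ) ≠ 0))

/-- an integer is integral at every finite place of `ℚ` (Mathlib's `valuation_le_one` on `𝓞 ℚ`). -/
private theorem valuation_intCast_le_one_rat (v : HeightOneSpectrum (𝓞 ℚ)) (n : ℤ) : v.valuation ℚ (n : ℚ) ≤ 1 := by
  rw [show (n : ℚ) = algebraMap (𝓞 ℚ) ℚ n by simp]
  exact v.valuation_le_one _

/-- **denominator control ⇒ integrality**: `den r ∣ M` with `v(M) = 1` gives `v(r) ≤ 1`. -/
theorem valuation_le_one_of_den_dvd (v : HeightOneSpectrum (𝓞 ℚ)) {r : ℚ} {M : ℤ}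
    (hM : v.valuation ℚ (M : ℚ) = 1) (h : (r.den : ℤ) ∣ M) : v.valuation ℚ r ≤ 1 := by
  obtain ⟨q, hq⟩ := h
  have hden : v.valuation ℚ ((r.den : ℤ) : ℚ) = 1 := by
    have h1 : v.valuation ℚ (((r.den : ℤ) : ℚ) * (q : ℚ)) = 1 := by
      rw [← hM, hq]; push_cast; rfl
    exact (valuation_eq_one_of_mul_eq_one (v.valuation ℚ) (valuation_intCast_le_one_rat v _)
      (valuation_intCast_le_one_rat v q) h1).1
  have hden' : v.valuation ℚ (r.den : ℚ) = 1 := by exact_mod_cast hden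
  conv_lhs => rw [← Rat.num_div_den r]
  rw [map_div₀, hden', div_one]
  exact valuation_intCast_le_one_rat v r.num

/-- outside `T(m)`: `v(2) = 1` and `v(m) = 1`. -/
theorem val_eq_one_of_not_mem_badT {m : ℤ} {v : HeightOneSpectrum (𝓞 ℚ)} (hv : v ∉ badT m) :
    v.valuation ℚ (2 : ℚ) = 1 ∧ v.valuation ℚ (m : ℚ) = 1 := by
  simp only [badT, Set.mem_union, Set.mem_setOf_eq, not_or, not_not] at hv
  exact hv

/-- **a DYADIC rational is `T(m)`-integral** (`2 ∈ T(m)`). -/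
theorem mem_integer_of_isDyadic (m : ℤ) {ξ : ℚ} (hξ : IsDyadic ξ) : ξ ∈ (badT m).integer ℚ := by
  obtain ⟨t, ht⟩ := hξ
  intro v hv
  refine valuation_le_one_of_den_dvd v (M := 2 ^ t) ?_ (by rw [ht]; push_cast; rfl)
  push_cast
  rw [map_pow, (val_eq_one_of_not_mem_badT hv).1, one_pow]

/-- dominance with `k ≥ 1` forces `deg c₀ ≥ 1`, in particular `c₀ ≠ 0`. -/
theorem ne_zero_of_domZero {k : ℕ} {c : ℕ → ℤ[X]} (hk : 1 ≤ k) (hdom : DomZero k c) : c 0 ≠ 0 := fun h0 => by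
  have := hdom 1 le_rfl hk
  rw [h0, natDegree_zero] at this
  exact Nat.not_lt_zero _ this

/-- **ORDINATES OVER DYADIC ABSCISSAE ARE `T(lc c₀)`-INTEGRAL** on a dominant pair of `x`-degree 2. -/
theorem ordinate_mem_integer {c : ℕ → ℤ[X]} (hdom : DomZero 2 c) {ξ r : ℚ} (hξ : IsDyadic ξ)
    (h : aeval r (c 0) + ξ * aeval r (c 1) + ξ ^ 2 * aeval r (c 2) = 0) :
    r ∈ (badT (c 0).leadingCoeff).integer ℚ := by
  obtain ⟨t, ht⟩ := hξ
  have hsum : ∑ j ∈ Finset.range (2 + 1), ξ ^ j * aeval r (c j) = 0 := by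
    simp only [Finset.sum_range_succ, Finset.sum_range_zero, pow_zero, one_mul, zero_add, pow_one]
    linear_combination h
  have hdvd := den_dvd_of_dyadic 2 c hdom (ne_zero_of_domZero (by norm_num) hdom) ht hsum
  intro v hv
  obtain ⟨h2, hm⟩ := val_eq_one_of_not_mem_badT hv
  refine valuation_le_one_of_den_dvd v ?_ hdvd
  push_cast
  rw [map_mul, map_pow, h2, hm, one_pow, one_mul]

/-- **SEPARABILITY OF `Δ` EXCLUDES A DEGENERATE FIBRE**: if `Δ = c₁² − 4c₀c₂` is separable over `ℚ` then at NO
rational `r` do `c₀(r), c₁(r), c₂(r)` all vanish (else `(Y − r)² ∣ Δ`), so the fibre polynomial in `x` is non-zero. -/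
theorem fibrePoly_ne_zero {c : ℕ → ℤ[X]} (hsep : ((pDisc c).map (Int.castRingHom ℚ)).Separable) (r : ℚ) :
    C (aeval r (c 2)) * X ^ 2 + C (aeval r (c 1)) * X + C (aeval r (c 0)) ≠ (0 : ℚ[X]) := by
  intro h0
  have h2 : aeval r (c 2) = 0 := by
    have h := congrArg (fun p : ℚ[X] => p.coeff 2) h0
    simp only [coeff_add, coeff_C_mul, coeff_X_pow, coeff_X, coeff_C, coeff_zero] at h
    norm_num at h
    exact h
  have h1 : aeval r (c 1) = 0 := by
    have h := congrArg (fun p : ℚ[X] => p.coeff 1) h0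
    simp only [coeff_add, coeff_C_mul, coeff_X_pow, coeff_X, coeff_C, coeff_zero] at h
    norm_num at h
    exact h
  have h0' : aeval r (c 0) = 0 := by
    have h := congrArg (fun p : ℚ[X] => p.coeff 0) h0
    simp only [coeff_add, coeff_C_mul, coeff_X_pow, coeff_X, coeff_C, coeff_zero] at h
    norm_num at h
    exact h
  set g := Int.castRingHom ℚ with hg
  have hroot : ∀ p : ℤ[X], aeval r p = 0 → X - C r ∣ p.map g := fun p hp => by
    rw [dvd_iff_isRoot, IsRoot.def, eval_map, hg, ← algebraMap_int_eq, ← aeval_def]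
    exact hp
  have hmap : (pDisc c).map g = (c 1).map g ^ 2 - 4 * (c 0).map g * (c 2).map g := by
    simp only [pDisc, ← coe_mapRingHom, map_sub, map_mul, map_pow, map_ofNat]
  have hsq : (X - C r) * (X - C r) ∣ (pDisc c).map g := by
    rw [hmap, pow_two]
    exact dvd_sub (mul_dvd_mul (hroot _ h1) (hroot _ h1))
      (mul_dvd_mul (dvd_mul_of_dvd_right (hroot _ h0') _) (hroot _ h2))
  exact not_isUnit_X_sub_C r (hsep.squarefree _ hsq)

/-- **THE ENGINE, SIEGEL FORM — FINITELY MANY ORDINATES OVER DYADIC ABSCISSAE** on `xPolyP 2 c` when `c₀` is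
DOMINANT (`DomZero 2 c`) and `Δ = pDisc c` is separable over `ℚ` of degree `≥ 3`: the points `(r, 2c₂(r)ξ + c₁(r))`,
`ξ ∈ ℤ[1/2]`, are `T`-integral points of the hyperelliptic curve `u² = Δ(r)`, `T` = the primes of `2·lc(c₀)` — and
SIEGEL'S THEOREM (§L, PROVED) leaves finitely many `r`. -/
theorem finite_ordinates_dom2 (c : ℕ → ℤ[X]) (hdom : DomZero 2 c)
    (hsep : ((pDisc c).map (Int.castRingHom ℚ)).Separable) (hdeg : 3 ≤ (pDisc c).natDegree) :
    {r : ℚ | ∃ ξ : ℚ, IsDyadic ξ ∧ bev (xPolyP 2 c) ξ r = 0}.Finite := by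
  have hc₀ : c 0 ≠ 0 := ne_zero_of_domZero (by norm_num) hdom
  set T : Set (HeightOneSpectrum (𝓞 ℚ)) := badT (c 0).leadingCoeff with hT_def
  have hT : T.Finite := badT_finite (leadingCoeff_ne_zero.mpr hc₀)
  set f : ℚ[X] := (pDisc c).map (Int.castRingHom ℚ) with hf_def
  have hf3 : 3 ≤ f.natDegree := by
    rwa [hf_def, natDegree_map_eq_of_injective (Int.castRingHom ℚ).injective_int]
  refine (finite_integer_sq_eq ℚ T hT f hsep hf3).subset ?_
  rintro r ⟨ξ, hξ, hb⟩
  have h := ratEq_of_bev_two hb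
  refine ⟨ordinate_mem_integer hdom hξ h, 2 * aeval r (c 2) * ξ + aeval r (c 1), ?_⟩
  rw [sq_eq_aeval_pDisc h, hf_def, eval_map, ← algebraMap_int_eq, ← aeval_def]

/-- **FINITELY MANY DYADIC ABSCISSAE** carrying a rational point of `xPolyP 2 c` (each ordinate carries at most two:
the fibre polynomial is non-zero by `fibrePoly_ne_zero`). -/
theorem finite_dyadicAbscissae_dom2 (c : ℕ → ℤ[X]) (hdom : DomZero 2 c)
    (hsep : ((pDisc c).map (Int.castRingHom ℚ)).Separable) (hdeg : 3 ≤ (pDisc c).natDegree) :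
    {ξ : ℚ | IsDyadic ξ ∧ ∃ r : ℚ, bev (xPolyP 2 c) ξ r = 0}.Finite := by
  have hR := finite_ordinates_dom2 c hdom hsep hdeg
  refine (hR.biUnion (t := fun r => {ξ : ℚ | IsRoot (C (aeval r (c 2)) * X ^ 2 + C (aeval r (c 1)) * X +
    C (aeval r (c 0))) ξ}) fun r _ => Polynomial.finite_setOf_isRoot (fibrePoly_ne_zero hsep r)).subset ?_
  rintro ξ ⟨hξ, r, h⟩
  refine Set.mem_biUnion (x := r) ⟨ξ, hξ, h⟩ ?_
  simp only [Set.mem_setOf_eq, IsRoot.def, eval_add, eval_mul, eval_C, eval_pow, eval_X]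
  linear_combination ratEq_of_bev_two h

/-- **FINITELY MANY RATIONAL POINTS WITH DYADIC ABSCISSA** on `xPolyP 2 c` (the form not tied to the levels). -/
theorem finite_dyadicPoints_dom2 (c : ℕ → ℤ[X]) (hdom : DomZero 2 c)
    (hsep : ((pDisc c).map (Int.castRingHom ℚ)).Separable) (hdeg : 3 ≤ (pDisc c).natDegree) :
    {p : ℚ × ℚ | IsDyadic p.1 ∧ bev (xPolyP 2 c) p.1 p.2 = 0}.Finite :=
  ((finite_dyadicAbscissae_dom2 c hdom hsep hdeg).prod (finite_ordinates_dom2 c hdom hsep hdeg)).subset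
    fun p ⟨h1, h2⟩ => ⟨⟨h1, p.2, h2⟩, p.1, h1, h2⟩

/-- **THE RECORD'S RESIDUAL BINDER DISCHARGED ON THE CLASS: `SiegelClause (xPolyP 2 c)`** (disjunct (A)) — PROVED. -/
theorem siegelClause_dom2 (c : ℕ → ℤ[X]) (hdom : DomZero 2 c)
    (hsep : ((pDisc c).map (Int.castRingHom ℚ)).Separable) (hdeg : 3 ≤ (pDisc c).natDegree) :
    SiegelClause (xPolyP 2 c) :=
  Or.inl (finite_dyadicAbscissae_dom2 c hdom hsep hdeg)

/-- **`LevelFinite (xPolyP 2 c)`** — HYPOTHESIS-FREE, through the record's own door `levelFinite_of_siegelClause`. -/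
theorem levelFinite_dom2 (c : ℕ → ℤ[X]) (hdom : DomZero 2 c)
    (hsep : ((pDisc c).map (Int.castRingHom ℚ)).Separable) (hdeg : 3 ≤ (pDisc c).natDegree) :
    LevelFinite (xPolyP 2 c) :=
  levelFinite_of_siegelClause (siegelClause_dom2 c hdom hsep hdeg)

/-- **`ThinFibreAt m₀ (xPolyP 2 c)` AT EVERY QUALITY `m₀`** (in particular at the residual quality `m₀ = 2`) — by the
tree's `thinFibreAt_of_levelFinite`. -/
theorem thinFibreAt_dom2 (c : ℕ → ℤ[X]) (hdom : DomZero 2 c)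
    (hsep : ((pDisc c).map (Int.castRingHom ℚ)).Separable) (hdeg : 3 ≤ (pDisc c).natDegree) (m₀ : ℕ) :
    ThinFibreAt m₀ (xPolyP 2 c) :=
  thinFibreAt_of_levelFinite (levelFinite_dom2 c hdom hsep hdeg) m₀

/-- `BddLevelEmpty (xPolyP 2 c)` (node 12's (b)) — by the tree's `bddLevelEmpty_iff_levelFinite`. -/
theorem bddLevelEmpty_dom2 (c : ℕ → ℤ[X]) (hdom : DomZero 2 c)
    (hsep : ((pDisc c).map (Int.castRingHom ℚ)).Separable) (hdeg : 3 ≤ (pDisc c).natDegree) :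
    BddLevelEmpty (xPolyP 2 c) :=
  (bddLevelEmpty_iff_levelFinite _).mpr (levelFinite_dom2 c hdom hsep hdeg)

/-- **ALL BUT FINITELY MANY LEVELS CARRY NO RATIONAL POINT AT ALL** (no height bound, no non-degeneracy clause). -/
theorem finite_pointed_levels_dom2 (c : ℕ → ℤ[X]) (hdom : DomZero 2 c)
    (hsep : ((pDisc c).map (Int.castRingHom ℚ)).Separable) (hdeg : 3 ≤ (pDisc c).natDegree) :
    {N : ℕ | ∃ r : ℚ, bev (xPolyP 2 c) (partialSum 2 N) r = 0}.Finite :=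
  (finite_levels_of_finite (finite_dyadicAbscissae_dom2 c hdom hsep hdeg)).subset fun N ⟨r, h⟩ =>
    ⟨isDyadic_sQ N, r, by rwa [sQ_cast]⟩

/-! #### §E′  THE CLASS, INTRINSIC IN `P` (census convention, as node 15's `GaussAt`) -/

/-- [class] definition (census convention): **THE DOMINANT HYPERELLIPTIC CLASS `DomHyper P`** — `x`-degree EXACTLY 2,
DOMINANCE of `c₀ = xCoeff P 0` (`deg xCoeff P j < deg xCoeff P 0` for `1 ≤ j ≤ xdeg P`: the conjunct of node 15's
`GaussAt`, verbatim), and the tree's intrinsic `x`-discriminant `xDisc P` (node 20) SEPARABLE over `ℚ` of degree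
`≥ 3`.  NO slope condition, NO root condition, NO local datum: where node 15 needs `SlopeCond m₀`, Siegel needs none. -/
def DomHyper (P : ℤ[X][X]) : Prop :=
  xdeg P = 2 ∧ (∀ j, 1 ≤ j → j ≤ xdeg P → (xCoeff P j).natDegree < (xCoeff P 0).natDegree) ∧
    ((xDisc P).map (Int.castRingHom ℚ)).Separable ∧ 3 ≤ (xDisc P).natDegree

/-- **PRESENTATION LEMMA**: on `xPolyP 2 c` with a genuine top (`c 2 ≠ 0`),
`DomHyper ↔ DomZero 2 c ∧ Δ(c) separable over ℚ ∧ 3 ≤ deg Δ(c)`. -/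
theorem domHyper_xPolyP_iff (c : ℕ → ℤ[X]) (h2 : c 2 ≠ 0) :
    DomHyper (xPolyP 2 c) ↔
      DomZero 2 c ∧ ((pDisc c).map (Int.castRingHom ℚ)).Separable ∧ 3 ≤ (pDisc c).natDegree := by
  rw [DomHyper, xdeg_xPolyP 2 c h2, xDisc_xPolyP_two]
  constructor
  · rintro ⟨-, hd, hs, hdeg⟩
    refine ⟨fun j hj1 hj2 => ?_, hs, hdeg⟩
    have := hd j hj1 hj2
    rwa [xCoeff_xPolyP, xCoeff_xPolyP, if_pos hj2, if_pos (by norm_num)] at this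
  · rintro ⟨hd, hs, hdeg⟩
    refine ⟨rfl, fun j hj1 hj2 => ?_, hs, hdeg⟩
    rw [xCoeff_xPolyP, xCoeff_xPolyP, if_pos hj2, if_pos (by norm_num)]
    exact hd j hj1 hj2

/-- a member of the class in presentation form: `P = xPolyP 2 (xCoeff P)` with the presentation hypotheses. -/
theorem DomHyper.presentation {P : ℤ[X][X]} (h : DomHyper P) :
    P = xPolyP 2 (xCoeff P) ∧ DomZero 2 (xCoeff P) ∧
      ((pDisc (xCoeff P)).map (Int.castRingHom ℚ)).Separable ∧ 3 ≤ (pDisc (xCoeff P)).natDegree := by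
  obtain ⟨hx, hd, hs, hdeg⟩ := h
  have hP : P = xPolyP 2 (xCoeff P) := by conv_lhs => rw [← xPolyP_xCoeff P, hx]
  have hD : xDisc P = pDisc (xCoeff P) := by conv_lhs => rw [hP, xDisc_xPolyP_two]
  rw [hD] at hs hdeg
  exact ⟨hP, fun j hj1 hj2 => hd j hj1 (hx.symm ▸ hj2), hs, hdeg⟩

/-- **THE THEOREM (node 23): `DomHyper P → ThinFibreAt m₀ P` at EVERY quality `m₀`** — hypothesis-free. -/
theorem thinFibreAt_of_domHyper {P : ℤ[X][X]} (h : DomHyper P) (m₀ : ℕ) : ThinFibreAt m₀ P := by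
  obtain ⟨hP, hd, hs, hdeg⟩ := h.presentation
  rw [hP]
  exact thinFibreAt_dom2 _ hd hs hdeg m₀

/-- `DomHyper P → LevelFinite P`. -/
theorem levelFinite_of_domHyper {P : ℤ[X][X]} (h : DomHyper P) : LevelFinite P := by
  obtain ⟨hP, hd, hs, hdeg⟩ := h.presentation
  rw [hP]
  exact levelFinite_dom2 _ hd hs hdeg

/-- `DomHyper P → SiegelClause P` (disjunct (A): the record's residual binder, PROVED on the class). -/
theorem siegelClause_of_domHyper {P : ℤ[X][X]} (h : DomHyper P) : SiegelClause P := by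
  obtain ⟨hP, hd, hs, hdeg⟩ := h.presentation
  rw [hP]
  exact siegelClause_dom2 _ hd hs hdeg

/-- `DomHyper P → BddLevelEmpty P`. -/
theorem bddLevelEmpty_of_domHyper {P : ℤ[X][X]} (h : DomHyper P) : BddLevelEmpty P :=
  (bddLevelEmpty_iff_levelFinite _).mpr (levelFinite_of_domHyper h)

/-- `DomHyper P →` all but finitely many levels of `P` carry no rational point at all. -/
theorem finite_pointed_levels_of_domHyper {P : ℤ[X][X]} (h : DomHyper P) :
    {N : ℕ | ∃ r : ℚ, bev P (partialSum 2 N) r = 0}.Finite := by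
  obtain ⟨hP, hd, hs, hdeg⟩ := h.presentation
  rw [hP]
  exact finite_pointed_levels_dom2 _ hd hs hdeg

/-- `DomHyper P →` finitely many rational points of `P` with dyadic abscissa. -/
theorem finite_dyadicPoints_of_domHyper {P : ℤ[X][X]} (h : DomHyper P) :
    {p : ℚ × ℚ | IsDyadic p.1 ∧ bev P p.1 p.2 = 0}.Finite := by
  obtain ⟨hP, hd, hs, hdeg⟩ := h.presentation
  rw [hP]
  exact finite_dyadicPoints_dom2 _ hd hs hdeg

end Engine

end Summit.Schanuel.Schanuel.Theorems.RootDecomp1KHyperellipticSiegel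

end
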